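import Literature.MathematicalPhysics.QuantumFieldTheory.Balaban1983to89.B4StripSums

/-!
# `BalabanUV.Beta.FP.ConstrainedBiLaplacianStrip` — road «FP» for binder row D1, row **RHOA-4-GH (localisation half)** of
# `LEAVES-FP.md` as RE-WORDED by RULING R-FP-29 (road-FP owner d1-p3-g8, journal 2026-08-21T03:04Z, adopting the locator
# N-ne9leaf08g31-1): FILE 1 of 3 — THE n-UNIFORM ZERO-FREE STRIP OF THE REGROUPED ALIAS DENOMINATOR OF THE CONSTRAINED
# (BI-)LAPLACIAN, with the constants EXPLICIT

NOT IN PRINT; OUR PROOF ATTEMPT (binder row G-an2-4 ∕ (CONV-C), prover part P3, fibre∕strip lineage).  HONEST DEPENDENCY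
(cell records, verbatim): «continuum YM on T⁴ ⇐ BetaPertH ∧ nine spine estimates (0/9 proved); BetaPertH ⇐ (D1) ∧ (D4) ∧
CAP+tail; G-an2-4 gates asym, D1 and NE2/3/4.»  HONEST FRAMING (cell contract, verbatim): «discharging `BetaPertH` makes
Bałaban's UV stability UNCONDITIONAL — a real constructive-QFT result; it is NOT the continuum limit and NOT the Clay problem.»
ABSOLUTE RULE (cell charter, verbatim): «No internally-minted statement may enter as a cited fact. Every hypothesis is either
kernel-proved in this package or a verbatim quotation of a PUBLISHED theorem with page reference. The manuscript(s) under audit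
are NOT citable for their own disputed steps — they are the thing under adjudication; programme-internal (2001/route/tribunal)
claims are never citable.»

THIS MODULE is [folklore] complex analysis over the momentum symbols ALREADY vendored (with their citation tags) by
`Literature.….Balaban1983to89.B4Strip` (`U` = the continued `|u_j(p′+l)|²` of [B4] (2.45), `DeltaXi` = the continued `Δ^ξ` of
(2.45), `Strip`, `strip_lower_bound`), `B4StripCauchy` (`Fat`, `rOf`, Cauchy's estimate `imLipschitz_of_fat`, `sum_norm_U_le`),
`B5Strip145Analytic` (`differentiableAt_U`) and `B4StripSums` (the REGROUPED ratio `R_k = Δ^ξ(p′)∕Δ^ξ(p′+2πk)`, `CR`, `W`,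
`norm_R_le`, `differentiableAt_R`).  It re-defines no symbol, re-proves no upstream inequality, introduces no `def … : Prop`,
cites nothing as a hypothesis, and contains no `sorry`.

## The mechanism (R-FP-29 (C), the locator's toy made a statement)

On `ℤ^D` tiled by blocks of side `n` (fine lattice `ξℤ^D`, `ξ = 1∕n`, in block units) the block averaging `Q′` is, in the
ALIAS fibre over a coarse momentum `p′ ∈ [−π,π]^D`, the RANK-ONE form `Q′*Q′ = |u⟩⟨u|`, `u_l = u(p′+l)`, `l = 2πk`,
`k ∈ {0,…,n−1}^D`.  Hence for a fibre-diagonal `A` (entries `A_l = A(p′+l)`; the ghost: `A = (Δ^ξ)²`, the Laplacian control: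
`A = Δ^ξ`) the CONSTRAINED inverse — the inverse of `A` compressed to `ker Q′`, `= lim_{a→∞}(A + aQ′*Q′)⁻¹` — is
`A⁻¹ − A⁻¹|u⟩⟨u|A⁻¹ ∕ ⟨u, A⁻¹u⟩` (Sherman–Morrison), and after regrouping through `A_0 = A(p′)` (the factor that has NO
`n`-uniform holomorphic continuation, `B4Strip.printed_factor_has_poles`) every fibre entry is (entire)∕(`A_l`, `l ≠ 0`, and
the REGROUPED ALIAS DENOMINATOR `A(p′)·⟨u, A⁻¹u⟩ = Σ_l |u(p′+l)|²·(A(p′)∕A(p′+l))`).  So the constrained inverse is singular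
exactly at the complex zeros of that denominator, and the exponential localisation rate ON SCALE n of its kernel (Paley–Wiener,
tree engine `B4ContourShift.latticeKernel_decay`) is the half-width of a zero-free strip — which must be `n`-UNIFORM.  For
`A = (Δ^ξ)^s` the denominator is `den n s p′ = Σ_k U_k(p′)·R_k(p′)^s` (§1).  (The locator's exact 1-D continuum-block widths,
`acosh 2` for `s = 1` and `acosh((−13+√105)∕2)⁻¹…` = `0.8426` for `s = 2`, are the sharp constants that the explicit
`kappaB d s` below under-estimates.)

## What is proved (every `d`, every `n ≥ 1`, every order `s : ℕ`; constants depend on `(d, s)` only)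

* §1 `den`, its real form `denr`, the real dictionary `den_ofRealVec` (on the real zone `den` IS the alias sum
  `Σ_l |u(p′+l)|²(Δ^ξ(p′)∕Δ^ξ(p′+l))^s`), and the dictionary with B4's regrouped denominator at `m² = 0`:
  `E n a 0 p = Δ^ξ(p) + a·den n 1 p` (`E_eq_DeltaXi_add_mul_den`) — `den n 1` is the `a → ∞` limit of `E∕a`.
* §2 REAL POSITIVITY, uniformly in `n ≥ 1`: every term of `denr` is `≥ 0` and the `l = 0` term is `≥ (4∕π²)^d` (Jordan,
  `B4Strip.Ur_zero_ge`): `denr_ge`, `re_den_ge`, `norm_den_ge_real`.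
* §3 on the fat region `Fat d r` (`r ≤ 1∕4`, `d r² ≤ 1∕16`): `norm_R_zero_le_CR` (`‖R_k‖ ≤ CR d 0`, every `k`),
  **`norm_den_le`** `‖den n s p‖ ≤ MB d s := 132^d·(CR d 0)^s`, **`differentiableAt_den`** (jointly holomorphic) and the slice
  form `differentiableAt_den_slice`.
* §4 THE STRIP: Cauchy's estimate ⟹ `den_imLipschitz` (constant `LambdaB d s = MB d s ∕ rOf d`); with
  `cB d = (4∕π²)^d∕2` and **`kappaB d s := min (rOf d) (cB d ∕ (LambdaB d s · d + 1)) > 0`**: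
  **`norm_den_ge_strip : ∀ p ∈ Strip d (kappaB d s), cB d ≤ ‖den n s p‖`** for EVERY `n ≥ 1`, `den_ne_zero_strip`,
  `norm_inv_den_le_strip`, `differentiableAt_den_strip`, and the packaged form **`uniform_zeroFree_strip`**.

NOT HERE (honest; FILES 2–3 of the INTENT, same lineage): the Sherman–Morrison fibre ENTRIES (the continued block-averaging
factor `v` and its continued conjugate, `B4StripSums.v`), their side periodicity, `StripRegular` and the kernel assembly by
`latticeKernel_decay`; the background-field dependence (B-jets); any torus periodisation.  LOCATED for the consumer: the
`n`-uniform localisation statement for the unit-lattice `(ιᵀΔ²ι)⁻¹` is the BLOCK-PAIR OPERATOR-NORM bound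
`‖1_{B(x⁰)}𝒢1_{B(y⁰)}‖ ≤ C_D n⁴ e^{−κ|x⁰−y⁰|_∞}` (prefactor `n⁴` = the gap half `FP/ConstrainedBiLaplacianGap`); an ENTRYWISE
bound with an `n`-uniform constant is false in `D = 4` at coincident points (`𝒢(x,x) ≍ log n`, the diagonal alias sum
`Σ_{k≠0}(Δ^ξ_k)^{−2} ≍ Σ_{0<|k|≤n}|k|^{−4}`).  0∕4 row-D1 binders touched.  NOT RHOA-4-GH, NOT hbook, NOT D1, NOT BetaPertH,
NOT continuum, NOT Clay.  Provenance: prover-b2b-balaban-gan24-p3-g21-0 (unit `b2b-balaban-gan24-p3`, gen 21; first refusal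
R-FP-29), 2026-08-21.
-/

noncomputable section

namespace Summit.QuantumFields.BalabanUV.Beta.FP.ConstrainedBiLaplacianStrip

open Complex Finset
open Literature.MathematicalPhysics.QuantumFieldTheory.Balaban1983to89
open Literature.MathematicalPhysics.QuantumFieldTheory.Balaban1983to89.B4Strip
open Literature.MathematicalPhysics.QuantumFieldTheory.Balaban1983to89.B4StripCauchy
open Literature.MathematicalPhysics.QuantumFieldTheory.Balaban1983to89.B5Strip145Analytic
open Literature.MathematicalPhysics.QuantumFieldTheory.Balaban1983to89.B4StripSums

variable {d : ℕ}

/-! ## §1 The regrouped alias denominator of order `s` and its real dictionary -/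

/-- [folklore] **THE REGROUPED ALIAS DENOMINATOR OF ORDER `s`**: `den n s p′ = Σ_{k ∈ {0..n−1}^d} U_k(p′)·R_k(p′)^s` with
`U_k` the continued `|u(p′+2πk)|²` (`B4Strip.U`) and `R_k = Δ^ξ(p′)∕Δ^ξ(p′+2πk)` (`R_0 = 1`, `B4StripSums.R` at `m² = 0`).
On the real zone it is `(Δ^ξ(p′))^s·Σ_l |u(p′+l)|²∕(Δ^ξ(p′+l))^s = (Δ^ξ)^s·⟨u, (Δ^ξ)^{−s}u⟩` — the Sherman–Morrison denominator of
the inverse of `(Δ^ξ)^s` constrained to `ker Q′` (`s = 2`: the ghost's bi-Laplacian; `s = 1`: the Laplacian).  Explicit; the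
only non-entire ingredients are the shifted `1∕Δ^ξ(p′+2πk)`, `k ≠ 0`, holomorphic on the fat region. -/
def den (n : ℕ) [NeZero n] (s : ℕ) (p : Fin d → ℂ) : ℂ :=
  ∑ k : Fin d → Fin n, U n k p * R n 0 k p ^ s

/-- [folklore] Real form of the regrouped ratio at `m² = 0`: `Rr_k(t) = 1` (`k = 0`), `= Δ^ξ(t)∕Δ^ξ(t+2πk)` (`k ≠ 0`). -/
def Rr (n : ℕ) [NeZero n] (k : Fin d → Fin n) (t : Fin d → ℝ) : ℝ :=
  if k = fun _ => (0 : Fin n) then 1 else DeltaXir n 0 t / DeltaXir n 0 (shiftr n k t)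

/-- [folklore] Real form of the regrouped alias denominator: `denr n s t = Σ_k Ur_k(t)·Rr_k(t)^s`. -/
def denr (n : ℕ) [NeZero n] (s : ℕ) (t : Fin d → ℝ) : ℝ :=
  ∑ k : Fin d → Fin n, Ur n k t * Rr n k t ^ s

/-- [folklore] `R_k` is real on real momenta: `R n 0 k (ofRealVec t) = Rr n k t`. -/
theorem R_zero_ofRealVec (n : ℕ) [NeZero n] (k : Fin d → Fin n) (t : Fin d → ℝ) :
    R n 0 k (ofRealVec t) = ((Rr n k t : ℝ) : ℂ) := by
  unfold R Rr
  split_ifs with hk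
  · simp
  · rw [shift_ofReal, DeltaXi_ofReal, DeltaXi_ofReal, Complex.ofReal_div]

/-- [folklore] **THE REAL DICTIONARY**: on real momenta `den n s (ofRealVec t) = denr n s t` — the row's alias sum
`Σ_l |û(p+2πl)|²∕|p+2πl|^{2s}` in [B4]'s normalisation, times `(Δ^ξ(p))^s`. -/
theorem den_ofRealVec (n : ℕ) [NeZero n] (s : ℕ) (t : Fin d → ℝ) :
    den n s (ofRealVec t) = ((denr n s t : ℝ) : ℂ) := by
  unfold den denr
  push_cast
  exact Finset.sum_congr rfl fun k _ => by rw [U_ofReal, R_zero_ofRealVec]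

/-- [folklore] **DICTIONARY WITH [B4]'s REGROUPED DENOMINATOR** at `m² = 0`: `E n a 0 p = Δ^ξ(p) + a·den n 1 p` — the order-one
denominator is the `a → ∞` limit of `E∕a` (`B4Strip.E`, (2.46)–(2.48) regrouped by the audit). -/
theorem E_eq_DeltaXi_add_mul_den (n : ℕ) [NeZero n] (a : ℝ) (p : Fin d → ℂ) :
    E n a 0 p = DeltaXi n 0 p + a * den n 1 p := by
  have hsplit : den n 1 p = U n (fun _ => (0 : Fin n)) p +
      ∑ k ∈ Finset.univ.erase (fun _ => (0 : Fin n)), U n k p * (DeltaXi n 0 p / DeltaXi n 0 (shift n k p)) := by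
    unfold den
    rw [← Finset.add_sum_erase Finset.univ (fun k => U n k p * R n 0 k p ^ 1) (Finset.mem_univ (fun _ => (0 : Fin n)))]
    congr 1
    · unfold R
      rw [if_pos rfl, one_pow, mul_one]
    · refine Finset.sum_congr rfl fun k hk => ?_
      unfold R
      rw [if_neg (Finset.ne_of_mem_erase hk), pow_one]
  rw [hsplit]
  unfold E
  ring

/-! ## §2 Real positivity, uniformly in `n ≥ 1` -/

/-- [folklore] `Rr_k(t) ≥ 0` (a ratio of the non-negative reals `Δ^ξ ≥ 0`, or `1`). -/
theorem Rr_nonneg (n : ℕ) [NeZero n] (k : Fin d → Fin n) (t : Fin d → ℝ) : 0 ≤ Rr n k t := by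
  unfold Rr
  split_ifs
  · exact zero_le_one
  · exact div_nonneg (DeltaXir_nonneg n 0 le_rfl t) (DeltaXir_nonneg n 0 le_rfl _)

/-- [folklore] Every term of `denr` is non-negative. -/
theorem denr_term_nonneg (n : ℕ) [NeZero n] (s : ℕ) (k : Fin d → Fin n) (t : Fin d → ℝ) :
    0 ≤ Ur n k t * Rr n k t ^ s :=
  mul_nonneg (Ur_nonneg n k t) (pow_nonneg (Rr_nonneg n k t) s)

/-- [folklore] **REAL POSITIVITY**: on the closed zone `|t_μ| ≤ π`, for EVERY `n ≥ 1` and every order `s`,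
`(4∕π²)^d ≤ denr n s t` (the `k = 0` term is `Ur_0(t)·1 ≥ (4∕π²)^d` by Jordan's inequality, `B4Strip.Ur_zero_ge`; the others are `≥ 0`). -/
theorem denr_ge (n : ℕ) [NeZero n] (s : ℕ) (t : Fin d → ℝ) (ht : ∀ μ, |t μ| ≤ Real.pi) :
    (4 / Real.pi ^ 2) ^ d ≤ denr n s t := by
  have hn : 1 ≤ n := Nat.one_le_iff_ne_zero.mpr (NeZero.ne n)
  have h0 : Ur n (fun _ => (0 : Fin n)) t * Rr n (fun _ => (0 : Fin n)) t ^ s = Ur n (fun _ => (0 : Fin n)) t := by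
    have : Rr n (fun _ => (0 : Fin n)) t = 1 := by unfold Rr; rw [if_pos rfl]
    rw [this, one_pow, mul_one]
  have hsingle := Finset.single_le_sum (f := fun k : Fin d → Fin n => Ur n k t * Rr n k t ^ s)
    (fun k _ => denr_term_nonneg n s k t) (Finset.mem_univ (fun _ => (0 : Fin n)))
  rw [h0] at hsingle
  exact (Ur_zero_ge n hn t ht).trans hsingle

/-- [folklore] Real positivity in complex currency: `(4∕π²)^d ≤ Re (den n s (ofRealVec t))` on the closed zone. -/
theorem re_den_ge (n : ℕ) [NeZero n] (s : ℕ) (t : Fin d → ℝ) (ht : ∀ μ, |t μ| ≤ Real.pi) :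
    (4 / Real.pi ^ 2) ^ d ≤ (den n s (ofRealVec t)).re := by
  rw [den_ofRealVec, Complex.ofReal_re]
  exact denr_ge n s t ht

/-- [folklore] Real positivity in norm: `(4∕π²)^d ≤ ‖den n s (ofRealVec t)‖` on the closed zone. -/
theorem norm_den_ge_real (n : ℕ) [NeZero n] (s : ℕ) (t : Fin d → ℝ) (ht : ∀ μ, |t μ| ≤ Real.pi) :
    (4 / Real.pi ^ 2) ^ d ≤ ‖den n s (ofRealVec t)‖ :=
  (re_den_ge n s t ht).trans (Complex.re_le_norm _)

/-! ## §3 Bounds and holomorphy on the fat region -/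

/-- [folklore] The uniform bound of the regrouped ratio at `m² = 0`: `‖R_k(q)‖ ≤ CR d 0` for EVERY `k` on the fat region
(`k = 0`: `‖1‖ = 1`; `k ≠ 0`: `B4StripSums.norm_R_le` and `W ≥ 1`). -/
theorem norm_R_zero_le_CR (n : ℕ) [NeZero n] {r : ℝ} (hr : r ≤ 1 / 4) (hdr : (d : ℝ) * r ^ 2 ≤ 1 / 16)
    {q : Fin d → ℂ} (hq : q ∈ Fat d r) (k : Fin d → Fin n) : ‖R n 0 k q‖ ≤ CR d 0 := by
  have hd : (0 : ℝ) ≤ 16 * d := by positivity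
  by_cases hk : k = fun _ => (0 : Fin n)
  · have h1 : ‖R n 0 k q‖ = 1 := by unfold R; rw [if_pos hk, norm_one]
    rw [h1]
    unfold CR
    nlinarith
  · have h := norm_R_le n 0 le_rfl hr hdr hq k hk
    have hW := one_le_W n k hk
    have h2 : (16 * (d : ℝ) + 0) * (64 / 7) / W n k ≤ (16 * d + 0) * (64 / 7) := by
      rw [div_le_iff₀ (by linarith)]
      nlinarith
    refine h.trans (h2.trans ?_)
    unfold CR
    linarith

/-- [folklore] The uniform bound `MB d s = 132^d·(CR d 0)^s` of the regrouped alias denominator on the fat region. -/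
def MB (d s : ℕ) : ℝ := 132 ^ d * CR d 0 ^ s

/-- [folklore] `MB d s > 0`. -/
theorem MB_pos (d s : ℕ) : 0 < MB d s := by
  unfold MB
  have h : 0 < CR d 0 := by unfold CR; positivity
  positivity

/-- [folklore] **THE FAT-REGION BOUND**: `‖den n s q‖ ≤ MB d s` on `Fat d r` (`r ≤ 1∕4`, `d r² ≤ 1∕16`), for EVERY `n ≥ 1`
(`B4StripCauchy.sum_norm_U_le`: `Σ_k ‖U_k‖ ≤ 132^d`, and `‖R_k‖^s ≤ (CR d 0)^s`). -/
theorem norm_den_le (n : ℕ) [NeZero n] (s : ℕ) {r : ℝ} (hr : r ≤ 1 / 4) (hdr : (d : ℝ) * r ^ 2 ≤ 1 / 16)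
    {q : Fin d → ℂ} (hq : q ∈ Fat d r) : ‖den n s q‖ ≤ MB d s := by
  have hCR : 0 ≤ CR d 0 := CR_nonneg d le_rfl
  unfold den MB
  calc ‖∑ k : Fin d → Fin n, U n k q * R n 0 k q ^ s‖
      ≤ ∑ k : Fin d → Fin n, ‖U n k q * R n 0 k q ^ s‖ := norm_sum_le _ _
    _ ≤ ∑ k : Fin d → Fin n, ‖U n k q‖ * CR d 0 ^ s := by
        refine Finset.sum_le_sum fun k _ => ?_
        rw [norm_mul, norm_pow]
        exact mul_le_mul_of_nonneg_left (pow_le_pow_left₀ (norm_nonneg _) (norm_R_zero_le_CR n hr hdr hq k) s)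
          (norm_nonneg _)
    _ = (∑ k : Fin d → Fin n, ‖U n k q‖) * CR d 0 ^ s := by rw [Finset.sum_mul]
    _ ≤ 132 ^ d * CR d 0 ^ s := mul_le_mul_of_nonneg_right (sum_norm_U_le n hr hq) (pow_nonneg hCR s)

/-- [folklore] **JOINT HOLOMORPHY ON THE FAT REGION**: `den n s` is differentiable (jointly in `p ∈ ℂ^d`) at every point of
`Fat d r` (`r ≤ 1∕4`, `d r² ≤ 1∕16`), uniformly in `n ≥ 1` (`differentiableAt_U`, `differentiableAt_R`). -/
theorem differentiableAt_den (n : ℕ) [NeZero n] (s : ℕ) {r : ℝ} (hr : r ≤ 1 / 4) (hdr : (d : ℝ) * r ^ 2 ≤ 1 / 16)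
    {q : Fin d → ℂ} (hq : q ∈ Fat d r) : DifferentiableAt ℂ (den n s) q := by
  show DifferentiableAt ℂ (fun p => ∑ k : Fin d → Fin n, U n k p * R n 0 k p ^ s) q
  apply DifferentiableAt.fun_sum
  intro k _
  exact (differentiableAt_U n hr hq k).mul ((differentiableAt_R n 0 le_rfl hr hdr hq k).pow s)

/-- [folklore] The coordinate slices of `den n s` through the points of the fat region are holomorphic (the hypothesis shape of
`B4StripCauchy.norm_deriv_slice_le` ∕ `imLipschitz_of_fat`). -/
theorem differentiableAt_den_slice (n : ℕ) [NeZero n] (s : ℕ) {r : ℝ} (hr : r ≤ 1 / 4) (hdr : (d : ℝ) * r ^ 2 ≤ 1 / 16)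
    {q : Fin d → ℂ} (hq : q ∈ Fat d r) (μ : Fin d) :
    DifferentiableAt ℂ (fun w => den n s (Function.update q μ w)) (q μ) := by
  have hupd : DifferentiableAt ℂ (fun w : ℂ => Function.update q μ w) (q μ) :=
    differentiableAt_pi.mpr (fun ν => (differentiable_update_apply q μ ν) (q μ))
  have hg : DifferentiableAt ℂ (den n s) (Function.update q μ (q μ)) := by
    rw [Function.update_eq_self]
    exact differentiableAt_den n s hr hdr hq
  exact hg.comp (q μ) hupd

/-! ## §4 The `n`-uniform zero-free strip -/

/-- [folklore] Half the real lower bound: `cB d = (4∕π²)^d∕2`. -/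
def cB (d : ℕ) : ℝ := (4 / Real.pi ^ 2) ^ d / 2

/-- [folklore] `cB d > 0`. -/
theorem cB_pos (d : ℕ) : 0 < cB d := by unfold cB; positivity

/-- [folklore] The imaginary-direction Lipschitz constant `LambdaB d s = MB d s ∕ rOf d` (Cauchy's estimate on the coordinate
discs of radius `rOf d = 1∕(4(d+1))`). -/
def LambdaB (d s : ℕ) : ℝ := MB d s / rOf d

/-- [folklore] `LambdaB d s > 0`. -/
theorem LambdaB_pos (d s : ℕ) : 0 < LambdaB d s := div_pos (MB_pos d s) (rOf_pos d)

/-- [folklore] **THE EXPLICIT, `n`-FREE HALF-WIDTH OF THE ZERO-FREE STRIP**: `kappaB d s = min (rOf d) (cB d ∕ (LambdaB d s · d + 1))`. -/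
def kappaB (d s : ℕ) : ℝ := min (rOf d) (cB d / (LambdaB d s * d + 1))

/-- [folklore] `kappaB d s > 0`. -/
theorem kappaB_pos (d s : ℕ) : 0 < kappaB d s := by
  unfold kappaB
  have h1 := rOf_pos d
  have h2 := cB_pos d
  have h3 : 0 < LambdaB d s * d + 1 := by
    have := (LambdaB_pos d s).le
    positivity
  exact lt_min h1 (div_pos h2 h3)

/-- [folklore] `kappaB d s ≤ rOf d` (the strip lies in the fat region `Fat d (rOf d)`). -/
theorem kappaB_le_rOf (d s : ℕ) : kappaB d s ≤ rOf d := min_le_left _ _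

/-- [folklore] The smallness relation `LambdaB·(d·kappaB) ≤ cB`. -/
theorem LambdaB_mul_kappaB_le (d s : ℕ) : LambdaB d s * (d * kappaB d s) ≤ cB d := by
  have hΛ := (LambdaB_pos d s).le
  have hc := (cB_pos d).le
  have hd : (0 : ℝ) ≤ d := Nat.cast_nonneg d
  have hden : 0 < LambdaB d s * d + 1 := by positivity
  have hκ : kappaB d s ≤ cB d / (LambdaB d s * d + 1) := min_le_right _ _
  calc LambdaB d s * (d * kappaB d s) = (LambdaB d s * d) * kappaB d s := by ring
    _ ≤ (LambdaB d s * d) * (cB d / (LambdaB d s * d + 1)) := mul_le_mul_of_nonneg_left hκ (by positivity)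
    _ ≤ (LambdaB d s * d + 1) * (cB d / (LambdaB d s * d + 1)) :=
        mul_le_mul_of_nonneg_right (by linarith) (div_nonneg hc hden.le)
    _ = cB d := by field_simp

/-- [folklore] **CAUCHY ⟹ THE IMAGINARY-DIRECTION LIPSCHITZ BOUND**: on every strip `Strip d κ` with `0 ≤ κ ≤ rOf d`, for EVERY
`n ≥ 1` and every order `s`, `‖den n s p − den n s (Re p)‖ ≤ LambdaB d s · Σ_μ |Im p_μ|` (`B4StripCauchy.imLipschitz_of_fat`). -/
theorem den_imLipschitz (n : ℕ) [NeZero n] (s : ℕ) {κ : ℝ} (hκ0 : 0 ≤ κ) (hκ : κ ≤ rOf d) :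
    ∀ p ∈ Strip d κ, ‖den n s p - den n s (ofRealVec (reVec p))‖ ≤ LambdaB d s * ∑ μ, |(p μ).im| :=
  imLipschitz_of_fat (den n s) (rOf_pos d) hκ0 hκ
    (fun _ hp ν => differentiableAt_den_slice n s (rOf_le d) (d_mul_rOf_sq_le d) hp ν)
    (fun _ hp => norm_den_le n s (rOf_le d) (d_mul_rOf_sq_le d) hp)

/-- [folklore] **THE `n`-UNIFORM ZERO-FREE STRIP OF THE REGROUPED ALIAS DENOMINATOR**: for EVERY `n ≥ 1`, every order `s` and
every `p′` with `|Re p′_μ| ≤ π`, `|Im p′_μ| ≤ kappaB d s`:  `cB d = (4∕π²)^d∕2 ≤ ‖den n s p′‖`.  (Real positivity `2·cB ≤ ‖den‖`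
on the zone + the Lipschitz bound + `LambdaB·d·kappaB ≤ cB`, `B4Strip.strip_lower_bound`.)  This is the strip-regularity INPUT
of R-FP-29's second arrow («alias sum `|p+2πl|^{−2s}`, strip regularity `n`-uniform per coarse momentum»), `s = 2` for the
ghost's constrained bi-Laplacian, `s = 1` for the constrained Laplacian. -/
theorem norm_den_ge_strip (n : ℕ) [NeZero n] (s : ℕ) :
    ∀ p ∈ Strip d (kappaB d s), cB d ≤ ‖den n s p‖ := by
  refine strip_lower_bound (den n s) (cB d) (LambdaB d s) (kappaB d s) (fun t ht => ?_)
    (den_imLipschitz n s (kappaB_pos d s).le (kappaB_le_rOf d s)) (LambdaB_pos d s).le (LambdaB_mul_kappaB_le d s)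
  have h := norm_den_ge_real n s t ht
  unfold cB
  linarith

/-- [folklore] `den n s p ≠ 0` on the strip `Strip d (kappaB d s)`, every `n ≥ 1`. -/
theorem den_ne_zero_strip (n : ℕ) [NeZero n] (s : ℕ) {p : Fin d → ℂ} (hp : p ∈ Strip d (kappaB d s)) :
    den n s p ≠ 0 := by
  intro h
  have := norm_den_ge_strip n s p hp
  rw [h, norm_zero] at this
  exact absurd this (not_le.mpr (cB_pos d))

/-- [folklore] The inverse denominator is uniformly bounded on the strip: `‖(den n s p)⁻¹‖ ≤ (cB d)⁻¹ = 2·(π²∕4)^d`. -/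
theorem norm_inv_den_le_strip (n : ℕ) [NeZero n] (s : ℕ) {p : Fin d → ℂ} (hp : p ∈ Strip d (kappaB d s)) :
    ‖(den n s p)⁻¹‖ ≤ (cB d)⁻¹ := by
  rw [norm_inv]
  exact inv_anti₀ (cB_pos d) (norm_den_ge_strip n s p hp)

/-- [folklore] `den n s` is holomorphic (jointly) at every point of the strip `Strip d (kappaB d s)` (the strip lies in
`Fat d (rOf d)`). -/
theorem differentiableAt_den_strip (n : ℕ) [NeZero n] (s : ℕ) {p : Fin d → ℂ} (hp : p ∈ Strip d (kappaB d s)) :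
    DifferentiableAt ℂ (den n s) p :=
  differentiableAt_den n s (rOf_le d) (d_mul_rOf_sq_le d)
    (strip_subset_fat (rOf_pos d).le (kappaB_le_rOf d s) hp)

/-- [folklore] The inverse denominator is holomorphic (jointly) at every point of the strip. -/
theorem differentiableAt_inv_den_strip (n : ℕ) [NeZero n] (s : ℕ) {p : Fin d → ℂ} (hp : p ∈ Strip d (kappaB d s)) :
    DifferentiableAt ℂ (fun q => (den n s q)⁻¹) p :=
  (differentiableAt_den_strip n s hp).inv (den_ne_zero_strip n s hp)

/-- [folklore] **PACKAGED FORM (the shape of `B4Strip.UniformStrip`, at `a = ∞`, any order)**: for every dimension `d` and order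
`s` there are `κ > 0` and `c > 0` — namely `kappaB d s`, `cB d` — such that for EVERY `n ≥ 1` the regrouped alias denominator
`den n s` is holomorphic with `c ≤ ‖den n s p′‖ ≤ MB d s` at every `p′` of the strip `|Re p′_μ| ≤ π`, `|Im p′_μ| ≤ κ`. -/
theorem uniform_zeroFree_strip (d s : ℕ) :
    ∃ κ c : ℝ, 0 < κ ∧ 0 < c ∧ ∀ (n : ℕ) [NeZero n], ∀ p ∈ Strip d κ,
      c ≤ ‖den n s p‖ ∧ ‖den n s p‖ ≤ MB d s ∧ DifferentiableAt ℂ (den n s) p :=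
  ⟨kappaB d s, cB d, kappaB_pos d s, cB_pos d, fun n _ p hp =>
    ⟨norm_den_ge_strip n s p hp,
      norm_den_le n s (rOf_le d) (d_mul_rOf_sq_le d) (strip_subset_fat (rOf_pos d).le (kappaB_le_rOf d s) hp),
      differentiableAt_den_strip n s hp⟩⟩

end Summit.QuantumFields.BalabanUV.Beta.FP.ConstrainedBiLaplacianStrip

end
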